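/-
Copyright: the b2b-balaban T⁴-continuum CRUX team, row NE7b OWNER lineage `t4-ne7b-p1` (gen 122). Project licence.
-/
import Summits.QuantumFields.BalabanUV.T4Continuum.Spine.NE7b.SupTorusPerturbedLocality
import Summits.QuantumFields.BalabanUV.T4Continuum.Spine.NE7b.SupTorusPropagatorModulus

/-!
# BLOCK `ℓ²` DECAY OF `(H + K)⁻¹g` FOR SOURCES WITH AN EXPONENTIAL BLOCK PROFILE — (141)'s common generalisation of the source lemmas, RE-RUN
# for the perturbed Hessian: `(H + K)h = g`, `Σ_{B_{y″}}g² ≤ G²e^{−2γ′ρ_s(y″,y₀)}`, `2κ ≤ γ′`, `κ < γ`, `εK_{γ−κ} < m_κ` ⟹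
# `Σ_{B_y}h² ≤ (m_κ − εK_{γ−κ})⁻²G²e^{4dκ}K_{2κ}e^{−2κρ_s(y,y₀)}`; in particular for BLOCK-CONSTANT sources `c∘bt` with `|c| ≤ c₀e^{−γ′ρ_s(·,y₀)}`
# (the responses' sources `T_K⁻¹(bt ·, y₀)` of (166)) — the input of every response ∕ covariance letter of the column for `H + K`
# (row NE7b, node U5c; (133)∕(141)∕(164) BY NAME; [folklore])

Cell `pub-balaban`, sub-cell `t4`, spine estimate NE7b (`T4WeightBudget.RelWeightBound`; the cell's OWN estimate — NOT PRINTED in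
[Bałaban 1983–89], NOT PROVED).  Crux-route work under `Spine/NE7b/` by the row OWNER (`t4-ne7b-p1` gen 122, file (167)) under FREEZE
(0)'s crux-prover clause; NOTHING of Bałaban's is named as a Lean object, valued or asserted; no `T4Continuum/Support` leaf typed; no `def`,
no notation; zero `sorry`.  Imports (BY NAME): the OWNER's (164) `…SupTorusPerturbedLocality` (`perturbed_inverseHessian_weighted_resolvent`;
through it (132) `torusDist_bond_lipschitz`, `isPseudoDist_torus`, (133) `weight_on_block`, `block_sum_le_total`, `sum_indicator_mul`), (141)
`…SupTorusPropagatorModulus` (`weightedSq_le_of_blockProfile`, the source-side letter, unchanged).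

WHY (located).  (164) re-ran (138) (sources in ONE block) for `H + K`; the response and covariance letters ((137)∕(139)∕(143)) consume the
more general source lemma of (141) — a source with an exponential BLOCK PROFILE — whose proof is (131)'s weighted letter with the weight
centred at the profile's centre plus (141) §1's source-side bound.  Replacing (131) by (164) §1 is the whole change.

WHAT IS PROVED ([folklore]; fine torus `Site d ((n+1)s)`, coarse `Site d s`; `(H + K)h` DISPLAYED; `m_κ`, `K_α` as in (164)):
* §1 **`perturbed_blockSq_le_of_blockProfile_source`** (`a ≥ 0`, `0 < κ ≤ 1`, `κ < γ`, `ε ≥ 0`, `εK_{γ−κ} < m_κ`, `2κ ≤ γ′`, `V ≥ −λ`,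
  `|K| ≤ εe^{−γρ_N}`, `Σ_{B_{y″}}g² ≤ G²e^{−2γ′ρ_s(y″,y₀)}` ∀ `y″`, `(H + K)h = g` ⟹ over EVERY block `y`:
  `Σ_z h(σ(chart (wm y) z))² ≤ (m_κ − εK_{γ−κ})⁻²(G²e^{2dκ}K_{2κ})e^{2dκ}e^{−2κρ_s(y,y₀)}`).
* §2 **`perturbed_blockSq_le_of_decaying_source`** (block-constant sources `g = c∘bt`, `|c y| ≤ c₀e^{−γ′ρ_s(y,y₀)}`: the same with
  `G² = (n+1)^d c₀²`).
* §3 toy.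

HONEST (what this is NOT).  A source lemma; the response ∕ covariance ∕ pointwise ∕ volume letters for `H + K` remain by-name re-runs;
cubic periods; scalar skeleton ((A3), NC-NE7b-α UNRULED); nothing of Bałaban's.  BY-NAME EFFECT ON THE WALL: NONE.  NE7b NOT PRINTED ∕ NOT
PROVED; spine PROVED 0∕9; rung (B)+1 on a FINITE torus — NOT infinite volume, NOT the mass gap, NOT Clay.  HONEST DEPENDENCY: continuum YM on
T⁴ ⇐ BetaPertH ∧ nine spine estimates (0∕9 proved); BetaPertH ⇐ (D1) ∧ (D4) ∧ CAP+tail; G-an2-4 gates asym, D1 and NE2∕3∕4.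
-/

set_option autoImplicit false

noncomputable section

namespace Summit.QuantumFields.BalabanUV.T4Continuum.NE7b.SupTorusPerturbedProfile

open Real
open Literature.MathematicalPhysics.QuantumFieldTheory.Balaban1983to89
open B6QGQLower276 (X e blk B side chart mem_B sum_B sum_B_const card_cube blk_chart)
open Beta (Site siteOf windowMap siteOf_windowMap siteOf_add)
open SupTorusBlockDistance (isPseudoDist_torus torusDist_bond_lipschitz)
open SupTorusActionForm (weight_on_block block_sum_le_total sum_indicator_mul)
open SupTorusPropagatorModulus (weightedSq_le_of_blockProfile)
open SupTorusPerturbedLocality (perturbed_inverseHessian_weighted_resolvent)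

variable {d : ℕ}

section Profile

variable (n : ℕ) (a : ℝ) (s : ℕ) [NeZero s] (ha : 0 ≤ a) {lam κ ε γ γ' G : ℝ} (hκ0 : 0 < κ) (hκ1 : κ ≤ 1) (hκγ : κ < γ) (hε : 0 ≤ ε)
  (hm : ε * (2 * (1 - exp (-(γ - κ)))⁻¹) ^ d < min 2 a - lam - 2 * d * κ ^ 2 - a * (exp (2 * d * κ) - 1)) (h2κ : 2 * κ ≤ γ')
  (V : Site d ((n + 1) * s) → ℝ) (hV : ∀ x, -lam ≤ V x)
  (K : Site d ((n + 1) * s) → Site d ((n + 1) * s) → ℝ)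
  (hK : ∀ x z, |K x z| ≤ ε * exp (-(γ * ∑ i, (((x i - z i).valMinAbs.natAbs : ℕ) : ℝ))))
  (y₀ : Site d s) (h g : Site d ((n + 1) * s) → ℝ)
  (hh : ∀ x, ((n : ℝ) + 1) ^ 2 * ∑ μ, (2 * h x - h (x + siteOf d ((n + 1) * s) (e μ)) - h (x - siteOf d ((n + 1) * s) (e μ)))
      + a / ((n : ℝ) + 1) ^ d * ∑ q ∈ B n (blk n (windowMap d ((n + 1) * s) x)), h (siteOf d ((n + 1) * s) q) + V x * h x
      + ∑ z, K x z * h z = g x)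

/-! ## §1. Sources with an exponential block profile -/

include ha hκ0 hκ1 hκγ hε hm h2κ hV hK hh in
/-- **BLOCK `ℓ²` DECAY OF `(H + K)⁻¹g` FOR A SOURCE WITH A BLOCK PROFILE**: `Σ_{B_{y″}}g² ≤ G²e^{−2γ′ρ_s(y″,y₀)}` for every block, `2κ ≤ γ′`
⟹ over EVERY block `y`: `Σ_z h(σ(chart (wm y) z))² ≤ (m_κ − εK_{γ−κ})⁻²(G²e^{2dκ}K_{2κ})e^{2dκ}e^{−2κρ_s(y,y₀)}` ((164) §1 with the centre at the
corner of `y₀` ⊛ (141) `weightedSq_le_of_blockProfile`). [folklore] -/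
theorem perturbed_blockSq_le_of_blockProfile_source
    (hg : ∀ y'' : Site d s, ∑ z : Fin d → Fin (n + 1), g (siteOf d ((n + 1) * s) (chart n (windowMap d s y'') z)) ^ 2
      ≤ G ^ 2 * exp (-(2 * γ' * ∑ i, (((y'' i - y₀ i).valMinAbs.natAbs : ℕ) : ℝ)))) (y : Site d s) :
    ∑ z : Fin d → Fin (n + 1), h (siteOf d ((n + 1) * s) (chart n (windowMap d s y) z)) ^ 2
      ≤ ((min 2 a - lam - 2 * d * κ ^ 2 - a * (exp (2 * d * κ) - 1) - ε * (2 * (1 - exp (-(γ - κ)))⁻¹) ^ d)⁻¹) ^ 2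
          * (G ^ 2 * exp (2 * d * κ) * (2 * (1 - exp (-(2 * κ)))⁻¹) ^ d) * exp (2 * d * κ)
        * exp (-(2 * κ * ∑ i, (((y i - y₀ i).valMinAbs.natAbs : ℕ) : ℝ))) := by
  classical
  set m := min 2 a - lam - 2 * d * κ ^ 2 - a * (exp (2 * d * κ) - 1) - ε * (2 * (1 - exp (-(γ - κ)))⁻¹) ^ d with hm_def
  set c' : Site d ((n + 1) * s) := siteOf d ((n + 1) * s) (chart n (windowMap d s y₀) 0) with hc'
  have hres := perturbed_inverseHessian_weighted_resolvent n a s ha hκ0.le hκ1 hκγ hε hm V hV K hK h g hh c'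
  have hsrc := weightedSq_le_of_blockProfile n s hκ0 h2κ y₀ g hg
  have hsol : exp (2 * (κ * (∑ i, (((y i - y₀ i).valMinAbs.natAbs : ℕ) : ℝ)) - d * κ))
        * ∑ z : Fin d → Fin (n + 1), h (siteOf d ((n + 1) * s) (chart n (windowMap d s y) z)) ^ 2
      ≤ ∑ x, (exp (κ / ((n : ℝ) + 1) * ∑ i, (((x i - c' i).valMinAbs.natAbs : ℕ) : ℝ)) * h x) ^ 2 := by
    rw [Finset.mul_sum]
    refine le_trans (Finset.sum_le_sum fun z _ => ?_)
      (block_sum_le_total n s y (F := fun x => (exp (κ / ((n : ℝ) + 1) * ∑ i, (((x i - c' i).valMinAbs.natAbs : ℕ) : ℝ)) * h x) ^ 2)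
        fun x => sq_nonneg _)
    have hw := (weight_on_block n s y y₀ z hκ0.le).1
    simp only [hc']
    rw [mul_pow, ← exp_nat_mul, Nat.cast_ofNat]
    exact mul_le_mul_of_nonneg_right (exp_le_exp.2 (by linarith)) (sq_nonneg _)
  have hS0 : 0 ≤ ∑ x, (exp (κ / ((n : ℝ) + 1) * ∑ i, (((x i - c' i).valMinAbs.natAbs : ℕ) : ℝ)) * h x) ^ 2 :=
    Finset.sum_nonneg fun _ _ => sq_nonneg _
  have hF0 : 0 ≤ ∑ x, (exp (κ / ((n : ℝ) + 1) * ∑ i, (((x i - c' i).valMinAbs.natAbs : ℕ) : ℝ)) * g x) ^ 2 :=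
    Finset.sum_nonneg fun _ _ => sq_nonneg _
  have hsq : ∑ x, (exp (κ / ((n : ℝ) + 1) * ∑ i, (((x i - c' i).valMinAbs.natAbs : ℕ) : ℝ)) * h x) ^ 2
      ≤ (m⁻¹) ^ 2 * (G ^ 2 * exp (2 * d * κ) * (2 * (1 - exp (-(2 * κ)))⁻¹) ^ d) := by
    have h1 := pow_le_pow_left₀ (Real.sqrt_nonneg _) hres 2
    rw [Real.sq_sqrt hS0, mul_pow, Real.sq_sqrt hF0] at h1
    refine h1.trans (mul_le_mul_of_nonneg_left ?_ (sq_nonneg _))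
    simpa only [hc'] using hsrc
  have hexp : 0 < exp (2 * (κ * (∑ i, (((y i - y₀ i).valMinAbs.natAbs : ℕ) : ℝ)) - d * κ)) := exp_pos _
  have key : ∑ z : Fin d → Fin (n + 1), h (siteOf d ((n + 1) * s) (chart n (windowMap d s y) z)) ^ 2
      ≤ (m⁻¹) ^ 2 * (G ^ 2 * exp (2 * d * κ) * (2 * (1 - exp (-(2 * κ)))⁻¹) ^ d)
        / exp (2 * (κ * (∑ i, (((y i - y₀ i).valMinAbs.natAbs : ℕ) : ℝ)) - d * κ)) := by
    rw [le_div_iff₀ hexp, mul_comm]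
    exact hsol.trans hsq
  refine key.trans (le_of_eq ?_)
  rw [div_eq_iff hexp.ne']
  have hE : exp (2 * d * κ) * exp (-(2 * κ * ∑ i, (((y i - y₀ i).valMinAbs.natAbs : ℕ) : ℝ)))
      * exp (2 * (κ * (∑ i, (((y i - y₀ i).valMinAbs.natAbs : ℕ) : ℝ)) - d * κ)) = 1 := by
    rw [← exp_add, ← exp_add, ← exp_zero]; congr 1; ring
  calc (m⁻¹) ^ 2 * (G ^ 2 * exp (2 * d * κ) * (2 * (1 - exp (-(2 * κ)))⁻¹) ^ d)
      = (m⁻¹) ^ 2 * (G ^ 2 * exp (2 * d * κ) * (2 * (1 - exp (-(2 * κ)))⁻¹) ^ d) * (exp (2 * d * κ)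
        * exp (-(2 * κ * ∑ i, (((y i - y₀ i).valMinAbs.natAbs : ℕ) : ℝ)))
        * exp (2 * (κ * (∑ i, (((y i - y₀ i).valMinAbs.natAbs : ℕ) : ℝ)) - d * κ))) := by rw [hE, mul_one]
    _ = _ := by ring

/-! ## §2. Block-constant sources with an exponential coarse profile -/

include ha hκ0 hκ1 hκγ hε hm h2κ hV hK hh in
/-- **BLOCK-CONSTANT DECAYING SOURCES**: `g = c∘bt` with `|c y| ≤ c₀e^{−γ′ρ_s(y,y₀)}` ⟹ over EVERY block `y`:
`Σ_z h(σ(chart (wm y) z))² ≤ (m_κ − εK_{γ−κ})⁻²((n+1)^d c₀²e^{2dκ}K_{2κ})e^{2dκ}e^{−2κρ_s(y,y₀)}` — the block profile of `c∘bt` is `(n+1)^d c y″²`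
(§1 with `G² = (n+1)^d c₀²`); the responses' sources `T_K⁻¹(bt ·, y₀)` of (166) are of this form. [folklore] -/
theorem perturbed_blockSq_le_of_decaying_source {c₀ : ℝ} (c : Site d s → ℝ)
    (hc : ∀ y', |c y'| ≤ c₀ * exp (-(γ' * ∑ i, (((y' i - y₀ i).valMinAbs.natAbs : ℕ) : ℝ))))
    (hgc : ∀ x, g x = c (siteOf d s (blk n (windowMap d ((n + 1) * s) x)))) (y : Site d s) :
    ∑ z : Fin d → Fin (n + 1), h (siteOf d ((n + 1) * s) (chart n (windowMap d s y) z)) ^ 2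
      ≤ ((min 2 a - lam - 2 * d * κ ^ 2 - a * (exp (2 * d * κ) - 1) - ε * (2 * (1 - exp (-(γ - κ)))⁻¹) ^ d)⁻¹) ^ 2
          * ((((n : ℝ) + 1) ^ d * c₀ ^ 2) * exp (2 * d * κ) * (2 * (1 - exp (-(2 * κ)))⁻¹) ^ d) * exp (2 * d * κ)
        * exp (-(2 * κ * ∑ i, (((y i - y₀ i).valMinAbs.natAbs : ℕ) : ℝ))) := by
  classical
  have hG : ∀ y'' : Site d s, ∑ z : Fin d → Fin (n + 1), g (siteOf d ((n + 1) * s) (chart n (windowMap d s y'') z)) ^ 2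
      ≤ (√(((n : ℝ) + 1) ^ d) * c₀) ^ 2 * exp (-(2 * γ' * ∑ i, (((y'' i - y₀ i).valMinAbs.natAbs : ℕ) : ℝ))) := by
    intro y''
    have hvol : (0 : ℝ) ≤ ((n : ℝ) + 1) ^ d := by positivity
    have hblk : ∀ z : Fin d → Fin (n + 1), g (siteOf d ((n + 1) * s) (chart n (windowMap d s y'') z)) = c y'' := fun z => by
      rw [hgc, SupTorusDirichletForm.blockOf_siteOf_of_mem n s (mem_B.2 (blk_chart n (windowMap d s y'') z))]
    simp only [hblk, Finset.sum_const, Finset.card_univ, nsmul_eq_mul]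
    rw [card_cube, mul_pow, Real.sq_sqrt hvol]
    have hcy := hc y''
    have hE := exp_pos (-(γ' * ∑ i, (((y'' i - y₀ i).valMinAbs.natAbs : ℕ) : ℝ)))
    have h1 : c y'' ^ 2 ≤ (c₀ * exp (-(γ' * ∑ i, (((y'' i - y₀ i).valMinAbs.natAbs : ℕ) : ℝ)))) ^ 2 := by
      rw [← sq_abs]; exact pow_le_pow_left₀ (abs_nonneg _) hcy 2
    have h2 : (c₀ * exp (-(γ' * ∑ i, (((y'' i - y₀ i).valMinAbs.natAbs : ℕ) : ℝ)))) ^ 2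
        = c₀ ^ 2 * exp (-(2 * γ' * ∑ i, (((y'' i - y₀ i).valMinAbs.natAbs : ℕ) : ℝ))) := by
      rw [mul_pow, sq (exp _), ← exp_add]; congr 1; congr 1; ring
    rw [h2] at h1
    calc ((n : ℝ) + 1) ^ d * c y'' ^ 2 ≤ ((n : ℝ) + 1) ^ d * (c₀ ^ 2 * exp (-(2 * γ' * ∑ i, (((y'' i - y₀ i).valMinAbs.natAbs : ℕ) : ℝ)))) :=
          mul_le_mul_of_nonneg_left h1 hvol
      _ = _ := by ring
  have h := perturbed_blockSq_le_of_blockProfile_source n a s ha hκ0 hκ1 hκγ hε hm h2κ V hV K hK y₀ h g hh hG y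
  have hvol : (0 : ℝ) ≤ ((n : ℝ) + 1) ^ d := by positivity
  have e : (√(((n : ℝ) + 1) ^ d) * c₀) ^ 2 = ((n : ℝ) + 1) ^ d * c₀ ^ 2 := by rw [mul_pow, Real.sq_sqrt hvol]
  rw [e] at h
  exact h

end Profile

/-! ## §3. Toy -/

/-- Toy (`d = 0`, `a = 1`, `λ = 0`, `κ = 1∕2`, `γ = 1`, `ε = 0`): the floor hypothesis `εK_{γ−κ} < m_κ` is inhabited. -/
example : (0 : ℝ) * (2 * (1 - exp (-((1 : ℝ) - 1 / 2)))⁻¹) ^ (0 : ℕ)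
    < min 2 (1 : ℝ) - 0 - 2 * ((0 : ℕ) : ℝ) * (1 / 2 : ℝ) ^ 2 - 1 * (exp (2 * ((0 : ℕ) : ℝ) * (1 / 2 : ℝ)) - 1) := by
  norm_num

end Summit.QuantumFields.BalabanUV.T4Continuum.NE7b.SupTorusPerturbedProfile
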